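import Literature.MathematicalPhysics.QuantumFieldTheory.Balaban1983to89.B9Eq3126H1kSliceGradRowClosed
import Literature.MathematicalPhysics.QuantumFieldTheory.Balaban1983to89.B9Eq316PenaltyStencilLetterTower
import Literature.MathematicalPhysics.QuantumFieldTheory.Balaban1983to89.B9Eq315QkLocalLetter

/-!
# `Balaban1983to89.B9Eq3147MiddleWordSliceGradRowClosed` — T. Bałaban, *Propagators for lattice gauge theories in a background field*, Commun. Math. Phys. **99**
# (1985) 389–434 [Balaban1985BackgroundPropagators] (3.147) p. 425 (*«𝔓 = I − G₁Q\*(QG₁Q\*)⁻¹Q − G₁DRD\*»*), (3.153) p. 426 (*«𝔊 = 𝔓G₁»*), (3.3) p. 391, Thm 3.3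
# p. 399 (the GRADIENT member of (3.42) for `G(U)`), Thm 3.11 p. 416, with [Balaban1985Variational] (110)–(111) p. 294, (115) p. 294, (117) p. 295: **THE SLICE-GRADIENT
# ROW OF THE MIDDLE WORD `H₁,kQ_kG₁,k` OF `𝔊̃_k = 𝔓_kG₁,k` ON PRINT's DIAGONAL, `∃ (α₁, B, δ)` BEFORE THE HEIGHT** — the NE9 owner's plan v12
# (`t4/b2b-balaban-t4-ne9-p1/g96/PLAN-V12-117-SOCKET.md` §2 (P2) «the gradient of the words: `∇_U(𝔓_kG₁,kf)` … `∇_UH₁,k`»), typed: the companion (K66)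
# `B9Eq3147MiddleWordSupRowClosed.exists_local_letter_H1kQkG1k`'s two (K61) `letter_comp` compositions with the OUTER factor `∇_μ∘H₁,k` read from this lineage's
# (K67) `B9Eq3126H1kSliceGradRowClosed.exists_local_gradLetter_H1k` (itself on the owner's (E2) `B9Eq326G1kSliceGradRowClosed`): (K64) `exists_local_letter_G1k`
# (fine bonds → fine bonds) ∘ THE `Q_k` LETTER (range `1`, size `2√d·C_Q`, HEIGHT-FREE — as (K66)) ∘ (K67) (coarse bonds → fine bonds, `∇_μ` post-composed)

statement-level skeleton of published theorems with citation tags; proofs where landed; nothing here is a claim about the Yang–Mills mass gap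

CITATION HEADER (lean-in-tree rule).  Audit cell `pub-balaban`, sub-cell `t4`, BINDER row NE9; filed by NE9 crux-team LEAF PROVER 05
(`b2b-balaban-t4-ne9-formalise-leaf-05`, gen 87).  Composed BY NAME, nothing restated: (K61) `letter_comp`, (K63) `B9Eq3126H1SupRowOfLetters.letter_of_range`,
(K64), (K67), ne9-leaf-03's `B9Eq315QkLocalLetter.QkOfU_apply_eq_zero_of_support` ∕ (PSK-tower) `B9Eq316PenaltyStencilLetterTower.norm_equiv_QkW_apply_le_blocks` ∕
(SBLT) `B9Eq315QkSingleBondLetter.equiv_QkW_apply` ∕ `B9Eq347LocalFromBlockDecay.norm_le_sqrt_mass_mul` ∕ (ECL) `B9Eq326LocalPartTowerSupDecayDiagonalClosed.sum_bondMass_bigBlock_le`,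
ne9-leaf-01's `B9Eq349BlockMultipliers.exists_block_clm_family`, `B9Eq349BlockDistanceWeight.tdist_shift_le_one`, `B4Sect5Torus.torusSum_le`, the owner's (VGT-a)
`B9Eq326LocalPartTowerSliceGradientRow.norm_covGrad_apply_le_of_slice` and (E2)'s slice device (an `⟨_, rfl⟩` continuous linear map — no definition).
Sources READ first-hand this generation (`paper:balaban1985-cmp99-background-propagators`, journal page = PDF page + 388): p. 391 (3.3), p. 397 (3.42), p. 399
Thm 3.3, p. 420 (3.126), p. 425 (3.147), p. 426 (3.153).  NOTHING of print's proof is reproduced; no constant of print is valued.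

WHAT IS PROVED (sorry-free; proof lane — no `def`; [folklore] composition BY NAME).
* **`exists_local_gradLetter_H1kQkG1k`** — `∃ α₁ B δ > 0` BEFORE `∀ n η c₀ c₁ m U …` ((K65)'s data block VERBATIM = (K64)'s + (FCLK)'s `hαL`, then `(μ : Fin d) (b)`):
  for every fine-bond field `f` supported over the big block `Π⁻¹(v)` with `‖f(b′)‖ ≤ F`, every component `μ` and fine bond `b`:
  `‖(D_U(H₁,kQ_kG₁,kf)_μ)(b)‖ ≤ B·e^{−δ·d_m(Π(b₋), v)}·F` and `‖(∇_U(H₁,kQ_kG₁,kf))(b, μ)‖ ≤ B·e^{−δ·d_m(Π(b₋), v)}·F`.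
  Rates: `κ := min(δ_G, δ_H′)` ((K64)'s and (K67)'s), the `Q_k` letter at rate `κ` (price `e^{κ}`), the rate lost ONCE (`δ := κ∕2`); `α₁ := min(α_G, α_H′)`;
  `B = B_G·(2√d·C_Q(α₁)·e^{κ})·K·B_H′·K`, `K = K_d(κ∕2)`.
HONEST SCOPE.  The gradient companion of (K66); with (K66), (K64), (E2) the middle word's pair of (3.42)-type letters is complete; the third word
`G₁,kD_UR_kD*_UG₁,k` is ne9-leaf-03's ∕ the owner's.  A theorem about the cell's MODEL; constants crude and symbolic; nothing of [B9] Thm 3.1 ∕ 3.3 ∕ 3.11 ∕ 3.13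
or [B11] (117) asserted, valued or discharged; «NE9 ⇐ the named binders»; NE9 NOT PRINTED ∕ NOT PROVED; row WALLED ON A MODEL (O-NE9-1; #5 UNRULED); spine
PROVED 0∕9; rung (B)+1 on a finite T⁴ — NOT infinite volume, NOT mass gap, NOT BetaPertH, NOT Clay.  HONEST DEPENDENCY: continuum YM on T⁴ ⇐ BetaPertH ∧ nine
spine estimates (0/9 proved); BetaPertH ⇐ (D1) ∧ (D4) ∧ CAP+tail; G-an2-4 gates asym, D1 and NE2/3/4.  NEW file behind (K67) (hence the owner's (E2)); nothing
modified.  Net new unproved facts: 0.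
-/

noncomputable section

set_option autoImplicit false

open scoped InnerProductSpace ComplexConjugate BigOperators

namespace Literature.MathematicalPhysics.QuantumFieldTheory.Balaban1983to89.B9Eq3147MiddleWordSliceGradRowClosed

open B4Sect5Torus (TSite tdist tdist_nonneg tdist_symm tdist_self tdist_triangle torusSum_le)
open B4Sect5Proof (latticeConst latticeConst_nonneg)
open B9SectCLatticeCarrier (Bond DirPair bpos btgt shift unshift)
open B9Eq311L2Pairing (WL2)
open B9Eq319QprimeTorus (fineP blockCoord)
open B7Prop1Explicit (U1 Wcx boxVec)
open B11Eq103H1Complex (SiteL2K BondL2K covDerivL2K)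
open B9Eq33CovDerivVector (covGrad)
open B9Eq310DeltaPrime (plaqHolU)
open B9Eq310HessianOperator (adTransportW)
open B9Eq315QTorus (perCfg cornerSite)
open B9Eq315QTower (towerP UlevOf)
open B9Eq316TowerFlatIsOneStep (towerP_eq_fineP_pow siteCast)
open B9Eq326OperatorTower (QkW laplaceAk G1k H1k)
open B9Eq324DeltaPrimeATower (laplacePrimeAk)
open B9Eq349BlockMultipliers (exists_block_clm_family)
open B9Eq349BlockDistanceWeight (tdist_shift_le_one)
open B9Eq326G1SupRowOfLetters (letter_comp)
open B9Eq3126H1SupRowOfLetters (letter_of_range)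
open B9Eq326G1kSupRowClosed (exists_local_letter_G1k)
open B9Eq3126H1kSliceGradRowClosed (exists_local_gradLetter_H1k)
open B9Eq326LocalPartTowerSliceGradientRow (norm_covGrad_apply_le_of_slice)
open B9Eq315QkLocalLetter (QkOfU_apply_eq_zero_of_support)
open B9Eq315QkSingleBondLetter (equiv_QkW_apply)
open B9Eq316PenaltyStencilLetterTower (norm_equiv_QkW_apply_le_blocks)
open B9Eq347LocalFromBlockDecay (norm_le_sqrt_mass_mul)
open B9Eq326LocalPartTowerSupDecayDiagonalClosed (sum_bondMass_bigBlock_le)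

variable {d : ℕ} (hd : 1 ≤ d) (L : ℕ) [NeZero L] (hL : 1 ≤ L) (hL3 : 3 ≤ L)
  {𝔸 : Type*} [NormedRing 𝔸] [NormedAlgebra ℂ 𝔸] [CompleteSpace 𝔸] [NormOneClass 𝔸] [StarRing 𝔸] [NormedStarGroup 𝔸] [StarModule ℂ 𝔸]
  {W : Type*} [NormedAddCommGroup W] [InnerProductSpace ℂ W] [FiniteDimensional ℂ W] (φ : W ≃ₗ[ℂ] 𝔸)
  {Mφ Mφ' : ℝ} (hMφ : 0 ≤ Mφ) (hMφ' : 0 ≤ Mφ') (hφ : ∀ w, ‖φ w‖ ≤ Mφ * ‖w‖) (hφ' : ∀ X, ‖φ.symm X‖ ≤ Mφ' * ‖X‖) (hstar : ∀ X : 𝔸, ‖star X‖ ≤ ‖X‖)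
  {a : ℝ} (ha : 0 < a) {a' : ℝ} (ha' : 0 < a') {ϱ : ℝ} (hϱ0 : 0 ≤ ϱ) (hϱ1 : ϱ < 1)
  (τ : 𝔸 →ₗ[ℂ] ℂ) {Cτ : ℝ} (hτ : ∀ X, ‖τ X‖ ≤ Cτ * ‖X‖) (hCτ : 0 ≤ Cτ) {Mτ : ℝ} (hτm : ∀ X Y : 𝔸, ‖τ (X * Y)‖ ≤ Mτ * ‖X‖ * ‖Y‖) (hMτ : 0 ≤ Mτ)
  {ρw : ℝ} (hρw : 0 ≤ ρw)
  (hτ₁ : ∀ X : 𝔸, τ (star X) = conj (τ X)) (hτ₂ : ∀ X Y : 𝔸, τ (X * Y) = τ (Y * X)) (hφτ : ∀ X Y : 𝔸, ⟪φ.symm X, φ.symm Y⟫_ℂ = τ (star X * Y))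
  (AQ : ℝ)

omit [NeZero L] in
/-- `e^{−r t} ≤ e^{−κ t}` for `κ ≤ r`, `0 ≤ t`. [folklore] -/
private theorem exp_weaken' {r κ t : ℝ} (hκ : κ ≤ r) (ht : 0 ≤ t) : Real.exp (-(r * t)) ≤ Real.exp (-(κ * t)) :=
  Real.exp_le_exp.2 (by nlinarith)

include hd hL hL3 hMφ hMφ' hφ hφ' hstar ha ha' hϱ0 hϱ1 hτ hCτ hτm hMτ hρw hτ₁ hτ₂ hφτ in
/-- **THE SLICE-GRADIENT ROW OF THE MIDDLE WORD `H₁,kQ_kG₁,k` ON PRINT's DIAGONAL, UNCONDITIONAL on the cell's MODEL letters.**  (K64) `exists_local_letter_G1k`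
(`(α_G, B_G, δ_G)`), (K67) `exists_local_gradLetter_H1k` (`(α_H′, B_H′, δ_H′)`, member 1, output `Π∘bpos`), the `Q_k` letter exactly as (K66) (range `1`, size
`2√d·C_Q(α₁)`), (K63) `letter_of_range`, two (K61) `letter_comp` with `torusSum_le`, the outer factor `Dcl ∘L Hcl` ((E2)'s slice device post-composed with `H₁,k`);
`κ := min(δ_G, δ_H′)`, `δ := κ∕2`, `α₁ := min(α_G, α_H′)`; the `∇_U` member by `norm_covGrad_apply_le_of_slice`.
[cite: Balaban1985BackgroundPropagators, (3.147) p.425, (3.153) p.426, (3.3) p.391, Thm 3.3 p.399, Thm 3.11 p.416; Balaban1985Variational, (111) p.294, (117) p.295] -/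
theorem exists_local_gradLetter_H1kQkG1k :
    ∃ α₁ B δ : ℝ, 0 < α₁ ∧ 0 ≤ B ∧ 0 < δ ∧
      ∀ (n : ℕ) (η : ℝ) (_hηL : η * (L : ℝ) ^ (n + 1) = 1) (c₀ c₁ : ℝ) [Fact (0 < c₀)] [Fact (0 < c₁)]
        (_hw : c₀ * ((L : ℝ) ^ (n + 1)) ^ d = c₁) (_hρ : |η| ^ d / c₀ ≤ ρw) (m : Fin d → ℕ) [∀ i, NeZero (m i)] (_hm : ∀ i, 1 ≤ m i)
        (U : Bond d (towerP L m (n + 1)) → 𝔸ˣ) (αU : ℕ → ℝ) (_hα0 : ∀ j, 0 ≤ αU j) (hα1 : ∀ j, αU j ≤ 1 / 64)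
        (hαL : ∀ j, 50 * (d + 1) * αU j * (L : ℝ) ^ d ≤ 1 / 2)
        (hU1 : ∀ (j : ℕ) (x : B7Prop1Explicit.Site d) (k : Fin d), perCfg (towerP L m (j + 1)) (UlevOf L m (n + 1) U j) x k ∈ U1 𝔸)
        (hreg : ∀ (j : ℕ) (y : TSite d (towerP L m j)) (k : Fin d) (ρ' : Fin d → Fin L),
          ‖((Wcx L (perCfg (towerP L m (j + 1)) (UlevOf L m (n + 1) U j)) (cornerSite L y) k (boxVec L ρ') : 𝔸ˣ) : 𝔸) - 1‖ ≤ αU j)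
        (εU : ℕ → ℝ) (_hεU : ∀ j, 0 ≤ εU j) (_hUε : ∀ (j : ℕ) (b : Bond d (towerP L m (j + 1))), ‖(UlevOf L m (n + 1) U j b : 𝔸) - 1‖ ≤ εU j)
        (_hLb : ∀ (j : ℕ) (b : Bond d (towerP L m (j + 1))), UlevOf L m (n + 1) U j b ∈ U1 𝔸)
        (α : ℝ) (_hα : 0 ≤ α) (_hαle : α ≤ α₁)
        (hUst : ∀ b, star (U b : 𝔸) = (((U b)⁻¹ : 𝔸ˣ) : 𝔸)) (_hUb : ∀ b, U b ∈ U1 𝔸) (_hUη : ∀ b, ‖(U b : 𝔸) - 1‖ ≤ α * η)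
        (_hpl : ∀ p : B9SectCLatticeCarrier.Plaq d (towerP L m (n + 1)), ‖(plaqHolU U p : 𝔸) - 1‖ ≤ α * η ^ 2)
        (_hUgrad : ∀ (x : TSite d (towerP L m (n + 1))) (μ : Fin d), ‖(U (x, μ) : 𝔸) - U (unshift μ x, μ)‖ ≤ α * η ^ 2)
        (_hRlev : ∀ (j : ℕ) (b : Bond d (towerP L m (j + 1))) (w : W), ‖adTransportW φ (UlevOf L m (n + 1) U j) b w‖ ≤ ‖w‖)
        (_hεg : ∀ j < n + 1, εU j ≤ α * ϱ ^ j) (_hAQ : ∑ j ∈ Finset.range (n + 1), αU j ≤ AQ)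
        (hpos' : ∀ x : SiteL2K ℂ d (towerP L m (n + 1)) c₀ W, x ≠ 0 → 0 < RCLike.re ⟪x, laplacePrimeAk L m n φ η U a' (c₁ := c₁) x⟫_ℂ)
        (hpos : ∀ x : BondL2K ℂ d (towerP L m (n + 1)) c₀ W, x ≠ 0 →
          0 < RCLike.re ⟪x, laplaceAk L m n φ η U hL αU hα1 hU1 hreg τ (c₀ := c₀) (c₁ := c₁) a x⟫_ℂ)
        (v : TSite d m) (f : BondL2K ℂ d (towerP L m (n + 1)) c₀ W) (F : ℝ)
        (_hfv : ∀ b', blockCoord (L ^ (n + 1)) m (siteCast (towerP_eq_fineP_pow L m (n + 1)) (bpos b')) ≠ v →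
          WL2.equiv ℂ (fun _ : Bond d (towerP L m (n + 1)) => c₀) W f b' = 0)
        (_hfF : ∀ b', ‖WL2.equiv ℂ (fun _ : Bond d (towerP L m (n + 1)) => c₀) W f b'‖ ≤ F) (μ : Fin d) (b : Bond d (towerP L m (n + 1))),
        ‖WL2.equiv ℂ (fun _ : Bond d (towerP L m (n + 1)) => c₀) W (covDerivL2K ℂ c₀ ((η : ℂ))⁻¹ (adTransportW φ U)
            ((WL2.equiv ℂ (fun _ : TSite d (towerP L m (n + 1)) => c₀) W).symm fun y =>
              WL2.equiv ℂ (fun _ : Bond d (towerP L m (n + 1)) => c₀) W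
                (H1k L m n φ η U hL αU hα1 hU1 hreg τ (c₀ := c₀) (c₁ := c₁) hαL hpos
                  (QkW L m n φ U hL αU hα1 hU1 hreg (c₀ := c₀) (c₁ := c₁) (G1k L m n φ η U hL αU hα1 hU1 hreg τ (c₀ := c₀) (c₁ := c₁) hpos f)))
                (y, μ))) b‖ ≤
          B * Real.exp (-(δ * tdist m (blockCoord (L ^ (n + 1)) m (siteCast (towerP_eq_fineP_pow L m (n + 1)) (bpos b))) v)) * F ∧
        ‖covGrad ((η : ℂ))⁻¹ (adTransportW φ U)
            (WL2.equiv ℂ (fun _ : Bond d (towerP L m (n + 1)) => c₀) W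
              (H1k L m n φ η U hL αU hα1 hU1 hreg τ (c₀ := c₀) (c₁ := c₁) hαL hpos
                (QkW L m n φ U hL αU hα1 hU1 hreg (c₀ := c₀) (c₁ := c₁) (G1k L m n φ η U hL αU hα1 hU1 hreg τ (c₀ := c₀) (c₁ := c₁) hpos f)))) (b, μ)‖ ≤
          B * Real.exp (-(δ * tdist m (blockCoord (L ^ (n + 1)) m (siteCast (towerP_eq_fineP_pow L m (n + 1)) (bpos b))) v)) * F := by
  classical
  obtain ⟨αG, BG, δG, hαG, hBG, hδG, HG⟩ := exists_local_letter_G1k hd L hL hL3 φ hMφ hMφ' hφ hφ' hstar ha ha' hϱ0 hϱ1 τ hτ hCτ hτm hMτ hρw hτ₁ hτ₂ hφτ AQ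
  obtain ⟨αH, BH, δH, hαH, hBH, hδH, HH⟩ := exists_local_gradLetter_H1k hd L hL hL3 φ hMφ hMφ' hφ hφ' hstar ha ha' hϱ0 hϱ1 τ hτ hCτ hτm hMτ hρw hτ₁ hτ₂ hφτ
    AQ
  set κ : ℝ := min δG δH with hκdef
  have hκ0 : 0 < κ := lt_min hδG hδH
  have hκG : κ ≤ δG := min_le_left _ _
  have hκH : κ ≤ δH := min_le_right _ _
  have hα₁0 : 0 < min αG αH := lt_min hαG hαH
  -- the height-free size of `Q_k` at the window `α₁ = min(α_G, α_H)`
  set CQ : ℝ := Mφ' * Mφ * Real.exp (Real.sqrt ((L : ℝ) ^ d) * (Real.sqrt (2 * d) * (102 * (d + 1) ^ 2 * L)) * (min αG αH / (1 - ϱ))) with hCQ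
  have hCQ0 : 0 ≤ CQ := by positivity
  set MQ : ℝ := CQ * (2 * Real.sqrt d) * Real.exp (κ * 1) with hMQ
  have hMQ0 : 0 ≤ MQ := by positivity
  set K : ℝ := latticeConst d (κ - κ / 2) with hKdef
  have hK0 : 0 ≤ K := latticeConst_nonneg d (by linarith)
  set Bs : ℝ := BG * MQ * K * BH * K with hBs
  have hBs0 : 0 ≤ Bs := by positivity
  refine ⟨min αG αH, Bs, κ / 2, hα₁0, hBs0, by positivity, ?_⟩
  intro n η hηL c₀ c₁ _ _ hw hρ m _ hm U αU hα0 hα1 hαL hU1 hreg εU hεU hUε hLb α hα hαle hUst hUb hUη hpl hUgrad hRlev hεg hAQ hpos' hpos v f F hfv hfF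
    μ b
  have hc₀ : (0 : ℝ) < c₀ := Fact.out
  have hc₁ : (0 : ℝ) < c₁ := Fact.out
  haveI : Nonempty (Bond d (towerP L m (n + 1))) := ⟨b⟩
  haveI : Nonempty (Bond d m) := ⟨(v, ⟨0, hd⟩)⟩
  -- the fine bond-block family
  obtain ⟨PB, hPB⟩ := exists_block_clm_family (𝕜 := ℂ) (w := fun _ : Bond d (towerP L m (n + 1)) => c₀) (V := W)
    (fun b' : Bond d (towerP L m (n + 1)) => blockCoord (L ^ (n + 1)) m (siteCast (towerP_eq_fineP_pow L m (n + 1)) (bpos b')))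
  -- the three CLMs
  obtain ⟨Gcl, hGcl⟩ : ∃ T : BondL2K ℂ d (towerP L m (n + 1)) c₀ W →L[ℂ] BondL2K ℂ d (towerP L m (n + 1)) c₀ W,
      T = LinearMap.toContinuousLinearMap (G1k L m n φ η U hL αU hα1 hU1 hreg τ (c₀ := c₀) (c₁ := c₁) hpos) := ⟨_, rfl⟩
  obtain ⟨Qcl, hQcl⟩ : ∃ T : BondL2K ℂ d (towerP L m (n + 1)) c₀ W →L[ℂ] BondL2K ℂ d m c₁ W,
      T = LinearMap.toContinuousLinearMap (QkW L m n φ U hL αU hα1 hU1 hreg (c₀ := c₀) (c₁ := c₁)) := ⟨_, rfl⟩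
  obtain ⟨Hcl, hHcl⟩ : ∃ T : BondL2K ℂ d m c₁ W →L[ℂ] BondL2K ℂ d (towerP L m (n + 1)) c₀ W,
      T = LinearMap.toContinuousLinearMap (H1k L m n φ η U hL αU hα1 hU1 hreg τ (c₀ := c₀) (c₁ := c₁) hαL hpos) := ⟨_, rfl⟩
  obtain ⟨Dcl, hDcl⟩ : ∃ T : BondL2K ℂ d (towerP L m (n + 1)) c₀ W →L[ℂ] BondL2K ℂ d (towerP L m (n + 1)) c₀ W,
      ∀ (u : BondL2K ℂ d (towerP L m (n + 1)) c₀ W) (b' : Bond d (towerP L m (n + 1))),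
        WL2.equiv ℂ (fun _ : Bond d (towerP L m (n + 1)) => c₀) W (T u) b' =
          WL2.equiv ℂ (fun _ : Bond d (towerP L m (n + 1)) => c₀) W (covDerivL2K ℂ c₀ ((η : ℂ))⁻¹ (adTransportW φ U)
            ((WL2.equiv ℂ (fun _ : TSite d (towerP L m (n + 1)) => c₀) W).symm fun y =>
              WL2.equiv ℂ (fun _ : Bond d (towerP L m (n + 1)) => c₀) W u (y, μ))) b' :=
    ⟨LinearMap.toContinuousLinearMap (covDerivL2K ℂ c₀ ((η : ℂ))⁻¹ (adTransportW φ U) ∘ₗ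
        (WL2.linearEquiv ℂ ℂ (fun _ : TSite d (towerP L m (n + 1)) => c₀)).symm.toLinearMap ∘ₗ
        LinearMap.funLeft ℂ W (fun y : TSite d (towerP L m (n + 1)) => ((y, μ) : Bond d (towerP L m (n + 1)))) ∘ₗ
        (WL2.linearEquiv ℂ ℂ (fun _ : Bond d (towerP L m (n + 1)) => c₀)).toLinearMap), fun _ _ => rfl⟩
  -- (L)(G₁,k; B_G, κ)
  have hG : ∀ (v : TSite d m) (f : BondL2K ℂ d (towerP L m (n + 1)) c₀ W) (F : ℝ),
      (∀ x, blockCoord (L ^ (n + 1)) m (siteCast (towerP_eq_fineP_pow L m (n + 1)) (bpos x)) ≠ v →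
        WL2.equiv ℂ (fun _ : Bond d (towerP L m (n + 1)) => c₀) W f x = 0) →
      (∀ x, ‖WL2.equiv ℂ (fun _ : Bond d (towerP L m (n + 1)) => c₀) W f x‖ ≤ F) →
      ∀ x, ‖WL2.equiv ℂ (fun _ : Bond d (towerP L m (n + 1)) => c₀) W (Gcl f) x‖ ≤
        BG * Real.exp (-(κ * tdist m (blockCoord (L ^ (n + 1)) m (siteCast (towerP_eq_fineP_pow L m (n + 1)) (bpos x))) v)) * F := by
    intro v f F hfv hfF x
    have hF : 0 ≤ F := (norm_nonneg _).trans (hfF x)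
    have h := HG n η hηL c₀ c₁ hw hρ m hm U αU hα0 hα1 hU1 hreg εU hεU hUε hLb α hα (hαle.trans (min_le_left _ _)) hUst hUb hUη hpl hUgrad hRlev hεg hAQ
      hpos' hpos v f F hfv hfF x
    rw [hGcl, LinearMap.coe_toContinuousLinearMap']
    exact h.trans (mul_le_mul_of_nonneg_right (mul_le_mul_of_nonneg_left (exp_weaken' hκG (tdist_nonneg m _ _)) hBG) hF)
  -- (L)(∇_μ∘H₁,k; B_H′, κ)
  have hH : ∀ (v : TSite d m) (z : BondL2K ℂ d m c₁ W) (F : ℝ), (∀ x, bpos x ≠ v → WL2.equiv ℂ (fun _ : Bond d m => c₁) W z x = 0) →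
      (∀ x, ‖WL2.equiv ℂ (fun _ : Bond d m => c₁) W z x‖ ≤ F) →
      ∀ x, ‖WL2.equiv ℂ (fun _ : Bond d (towerP L m (n + 1)) => c₀) W ((Dcl ∘L Hcl) z) x‖ ≤
        BH * Real.exp (-(κ * tdist m (blockCoord (L ^ (n + 1)) m (siteCast (towerP_eq_fineP_pow L m (n + 1)) (bpos x))) v)) * F := by
    intro v z F hzv hzF x
    have hF : 0 ≤ F := (norm_nonneg _).trans (hzF (v, ⟨0, hd⟩))
    have h := (HH n η hηL c₀ c₁ hw hρ m hm U αU hα0 hα1 hαL hU1 hreg εU hεU hUε hLb α hα (hαle.trans (min_le_right _ _)) hUst hUb hUη hpl hUgrad hRlev hεg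
      hAQ hpos' hpos v z F hzv hzF μ x).1
    rw [ContinuousLinearMap.comp_apply, hDcl, hHcl, LinearMap.coe_toContinuousLinearMap']
    exact h.trans (mul_le_mul_of_nonneg_right (mul_le_mul_of_nonneg_left (exp_weaken' hκH (tdist_nonneg m _ _)) hBH) hF)
  -- the bond-block mass `d·c₁` and the block norms of a bounded field
  have hμB : ∀ u : TSite d m, ∑ x : Bond d (towerP L m (n + 1)),
      (if blockCoord (L ^ (n + 1)) m (siteCast (towerP_eq_fineP_pow L m (n + 1)) (bpos x)) = u then c₀ else 0) ≤ (d : ℝ) * c₁ := by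
    intro u
    have h := sum_bondMass_bigBlock_le L m n hc₀.le u
    calc _ ≤ c₀ * (d * ((L : ℝ) ^ (n + 1)) ^ d) := h
      _ = (d : ℝ) * c₁ := by rw [← hw]; ring
  have hblk : ∀ (u : BondL2K ℂ d (towerP L m (n + 1)) c₀ W) (F : ℝ), 0 ≤ F →
      (∀ x, ‖WL2.equiv ℂ (fun _ : Bond d (towerP L m (n + 1)) => c₀) W u x‖ ≤ F) → ∀ y : TSite d m, ‖PB y u‖ ≤ Real.sqrt ((d : ℝ) * c₁) * F := by
    intro u F hF huF y
    refine norm_le_sqrt_mass_mul (w := fun _ : Bond d (towerP L m (n + 1)) => c₀)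
      (π := fun b' : Bond d (towerP L m (n + 1)) => blockCoord (L ^ (n + 1)) m (siteCast (towerP_eq_fineP_pow L m (n + 1)) (bpos b')))
      y (hμB y) (PB y u) hF (fun x hx => ?_) (fun x => ?_)
    · rw [hPB, if_neg hx]
    · rw [hPB]
      by_cases hx : blockCoord (L ^ (n + 1)) m (siteCast (towerP_eq_fineP_pow L m (n + 1)) (bpos x)) = y
      · rw [if_pos hx]; exact huF x
      · rw [if_neg hx, norm_zero]; exact hF
  -- `Q_k`: size (height-free) and range `1`
  have hsd : Real.sqrt ((d : ℝ) * c₁) = Real.sqrt d * Real.sqrt c₁ := Real.sqrt_mul (Nat.cast_nonneg d) c₁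
  have hsc : 0 < Real.sqrt c₁ := Real.sqrt_pos.2 hc₁
  have hexpα : Real.exp (Real.sqrt ((L : ℝ) ^ d) * (Real.sqrt (2 * d) * (102 * (d + 1) ^ 2 * L)) * (α / (1 - ϱ))) ≤
      Real.exp (Real.sqrt ((L : ℝ) ^ d) * (Real.sqrt (2 * d) * (102 * (d + 1) ^ 2 * L)) * (min αG αH / (1 - ϱ))) := by
    have h1ϱ : 0 < 1 - ϱ := by linarith
    exact Real.exp_le_exp.2 (mul_le_mul_of_nonneg_left (div_le_div_of_nonneg_right hαle h1ϱ.le) (by positivity))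
  have hQM : ∀ (u : BondL2K ℂ d (towerP L m (n + 1)) c₀ W) (F : ℝ), (∀ x, ‖WL2.equiv ℂ (fun _ : Bond d (towerP L m (n + 1)) => c₀) W u x‖ ≤ F) →
      ∀ c, ‖WL2.equiv ℂ (fun _ : Bond d m => c₁) W (Qcl u) c‖ ≤ CQ * (2 * Real.sqrt d) * F := by
    intro u F huF c
    have hF : 0 ≤ F := (norm_nonneg _).trans (huF b)
    have h := norm_equiv_QkW_apply_le_blocks L m n φ U hL αU hα1 hU1 hreg hMφ hφ hMφ' hφ' εU hεU hUε hϱ0 hϱ1 hα hεg hPB hw.symm u c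
    have h1 := hblk u F hF huF c.1
    have h2 := hblk u F hF huF (shift c.2 c.1)
    rw [hQcl, LinearMap.coe_toContinuousLinearMap']
    refine h.trans ?_
    calc Mφ' * Mφ * Real.exp (Real.sqrt ((L : ℝ) ^ d) * (Real.sqrt (2 * d) * (102 * (d + 1) ^ 2 * L)) * (α / (1 - ϱ))) / Real.sqrt c₁ *
          (‖PB c.1 u‖ + ‖PB (shift c.2 c.1) u‖)
        ≤ Mφ' * Mφ * Real.exp (Real.sqrt ((L : ℝ) ^ d) * (Real.sqrt (2 * d) * (102 * (d + 1) ^ 2 * L)) * (min αG αH / (1 - ϱ))) / Real.sqrt c₁ *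
          (Real.sqrt ((d : ℝ) * c₁) * F + Real.sqrt ((d : ℝ) * c₁) * F) := by
          refine mul_le_mul ?_ (add_le_add h1 h2) (by positivity) (by positivity)
          exact div_le_div_of_nonneg_right (mul_le_mul_of_nonneg_left hexpα (by positivity)) hsc.le
      _ = CQ * (2 * Real.sqrt d) * F := by
          rw [hCQ, hsd]
          field_simp
          ring
  have hQρ : ∀ (v : TSite d m) (u : BondL2K ℂ d (towerP L m (n + 1)) c₀ W),
      (∀ x, blockCoord (L ^ (n + 1)) m (siteCast (towerP_eq_fineP_pow L m (n + 1)) (bpos x)) ≠ v →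
        WL2.equiv ℂ (fun _ : Bond d (towerP L m (n + 1)) => c₀) W u x = 0) →
      ∀ c : Bond d m, (1 : ℝ) < tdist m (bpos c) v → WL2.equiv ℂ (fun _ : Bond d m => c₁) W (Qcl u) c = 0 := by
    intro v u huv c hc
    have h1 : c.1 ≠ v := by
      intro h1
      have : tdist m (bpos c) v = 0 := by rw [show bpos c = c.1 from rfl, h1, tdist_self]
      linarith
    have h2 : shift c.2 c.1 ≠ v := by
      intro h2
      have : tdist m (bpos c) v ≤ 1 := by rw [show bpos c = c.1 from rfl, ← h2]; exact tdist_shift_le_one hm c.1 c.2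
      linarith
    rw [hQcl, LinearMap.coe_toContinuousLinearMap', equiv_QkW_apply,
      QkOfU_apply_eq_zero_of_support L m hL (n + 1) U αU hα1 hU1 hreg v _ (fun b' hb' => by rw [huv b' hb', map_zero]) c h1 h2, map_zero]
  have hQ := letter_of_range (tdist m)
    (fun x : Bond d (towerP L m (n + 1)) => blockCoord (L ^ (n + 1)) m (siteCast (towerP_eq_fineP_pow L m (n + 1)) (bpos x)))
    (fun c : Bond d m => bpos c) Qcl hκ0.le hQM hQρ
  -- the two compositions on the torus, the rate lost once
  have hgap : 0 < κ - κ / 2 := by linarith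
  have hS : ∀ w : TSite d m, ∑ u : TSite d m, Real.exp (-((κ - κ / 2) * tdist m w u)) ≤ K := fun w => torusSum_le d hm hgap w
  have h₁ := letter_comp (tdist m)
    (fun x : Bond d (towerP L m (n + 1)) => blockCoord (L ^ (n + 1)) m (siteCast (towerP_eq_fineP_pow L m (n + 1)) (bpos x)))
    (fun x : Bond d (towerP L m (n + 1)) => blockCoord (L ^ (n + 1)) m (siteCast (towerP_eq_fineP_pow L m (n + 1)) (bpos x)))
    (fun c : Bond d m => bpos c) Gcl Qcl (tdist_nonneg m) (fun u y w => tdist_triangle hm u y w) hBG hMQ0 (by positivity : (0 : ℝ) ≤ κ / 2)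
    (by linarith : κ / 2 ≤ κ) hG hQ hS
  have h₂ := letter_comp (tdist m)
    (fun x : Bond d (towerP L m (n + 1)) => blockCoord (L ^ (n + 1)) m (siteCast (towerP_eq_fineP_pow L m (n + 1)) (bpos x)))
    (fun c : Bond d m => bpos c)
    (fun x : Bond d (towerP L m (n + 1)) => blockCoord (L ^ (n + 1)) m (siteCast (towerP_eq_fineP_pow L m (n + 1)) (bpos x)))
    (Qcl ∘L Gcl) (Dcl ∘L Hcl) (tdist_nonneg m) (fun u y w => tdist_triangle hm u y w) (by positivity : (0 : ℝ) ≤ BG * MQ * K) hBH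
    (by positivity : (0 : ℝ) ≤ κ / 2) le_rfl h₁ hH hS v f F hfv hfF b
  have e : ((Dcl ∘L Hcl) ∘L (Qcl ∘L Gcl)) f =
      Dcl (H1k L m n φ η U hL αU hα1 hU1 hreg τ (c₀ := c₀) (c₁ := c₁) hαL hpos
        (QkW L m n φ U hL αU hα1 hU1 hreg (c₀ := c₀) (c₁ := c₁) (G1k L m n φ η U hL αU hα1 hU1 hreg τ (c₀ := c₀) (c₁ := c₁) hpos f))) := by
    rw [hHcl, hQcl, hGcl]
    rfl
  rw [e, hDcl] at h₂
  rw [hBs]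
  exact ⟨h₂, norm_covGrad_apply_le_of_slice _ _ _ b μ h₂⟩

end Literature.MathematicalPhysics.QuantumFieldTheory.Balaban1983to89.B9Eq3147MiddleWordSliceGradRowClosed

end
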